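import Literature.Algebra.EuclideanLattices.RegevDualQuery
import HarnessLib

/-!
# The smoothing parameter scales: `η_ε(c · L) = c · η_ε(L)` (glue groundwork for MR07 Thm. 5.9 on a scaled lattice)

Topic `Algebra/EuclideanLattices` (family `pqc`). Micciancio–Regev 2007, §3 (Def. 3.1: `η_ε(L)` is the least
`s > 0` with `ρ_{1/s}(L* ∖ {0}) ≤ ε`) with Micciancio–Goldwasser Ch. 1 §1 (`(c L)* = c⁻¹ L*`): for `c > 0`
the dual Gaussian mass of `c · L` at width `1/s` is that of `L` at width `1/(s/c)`
(`gaussianMass_inv_dual_smul`), hence the defining sets are homothetic and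
**`smoothingParameter_pointwise_smul`**: `η_ε(c · L) = c · η_ε(L)`. Written as glue groundwork for a
machine-level attempt of MR07 Thm. 5.9 presented on a scaled copy `c · Λ` of the instance's lattice
(`MRThm59Scaling.invMatrix_transpose_model`): the `IncGDD` promise `r > g η_ε(Λ)` is invariant under
`(Λ, S, t, r) ↦ (cΛ, cS, ct, cr)`. Theorems only.

## References

* D. Micciancio, O. Regev, *Worst-case to average-case reductions based on Gaussian measures*,
  SIAM J. Comput. 37 (2007) 267–302, §3 Def. 3.1.
* D. Micciancio, S. Goldwasser, *Complexity of Lattice Problems*, Kluwer 2002, Ch. 1 §1 (duality and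
  scaling) [MicciancioGoldwasser2002].
-/

noncomputable section

namespace Literature.Algebra.EuclideanLattices

namespace MRThm59

open Submodule
open scoped Pointwise ENNReal

variable {E : Type*} [NormedAddCommGroup E] [InnerProductSpace ℝ E]

/-- The nonzero dual vectors of `c · L` are `c⁻¹ ·` the nonzero dual vectors of `L`. [cite: MicciancioGoldwasser2002, Ch. 1 §1] -/
theorem mem_dual_smul_diff_iff (L : Submodule ℤ E) {c : ℝ} (hc : c ≠ 0) (x : E) :
    x ∈ (dualLattice (c • L) : Set E) \ {0} ↔ c • x ∈ (dualLattice L : Set E) \ {0} := by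
  rw [dualLattice_pointwise_smul L hc]
  simp only [Set.mem_sdiff, Set.mem_singleton_iff, SetLike.mem_coe, Submodule.mem_smul_pointwise_iff_exists]
  constructor
  · rintro ⟨⟨y, hy, rfl⟩, h0⟩
    refine ⟨by rwa [smul_smul, mul_inv_cancel₀ hc, one_smul], fun h => h0 ?_⟩
    rw [smul_eq_zero] at h
    rcases h with h | h
    · exact absurd h hc
    · exact h
  · rintro ⟨hy, h0⟩
    refine ⟨⟨c • x, hy, by rw [smul_smul, inv_mul_cancel₀ hc, one_smul]⟩, fun h => h0 (by rw [h, smul_zero])⟩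

/-- **The dual Gaussian mass of a scaled lattice**: `ρ_{1/s}((cL)* ∖ 0) = ρ_{1/(s/c)}(L* ∖ 0)` for `c > 0`
(reindex along `x ↦ c x`, `ρ_{1/s}(c⁻¹ y) = ρ_{c/s}(y)`). [cite: MicciancioRegev2007, §3 (Def. 3.1) with MicciancioGoldwasser2002 Ch. 1 §1] -/
theorem gaussianMass_inv_dual_smul (L : Submodule ℤ E) {c : ℝ} (hc : 0 < c) (s : ℝ) :
    gaussianMass (1 / s) 0 ((dualLattice (c • L) : Set E) \ {0}) = gaussianMass (1 / (s / c)) 0 ((dualLattice L : Set E) \ {0}) := by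
  have hc0 : c ≠ 0 := hc.ne'
  set A : Set E := (dualLattice (c • L) : Set E) \ {0} with hA
  set B : Set E := (dualLattice L : Set E) \ {0} with hB
  have hmem : ∀ x : A, c • (x : E) ∈ B := fun x => (mem_dual_smul_diff_iff L hc0 x).1 x.2
  have hmem' : ∀ y : B, c⁻¹ • (y : E) ∈ A := fun y =>
    (mem_dual_smul_diff_iff L hc0 _).2 (by rw [smul_smul, mul_inv_cancel₀ hc0, one_smul]; exact y.2)
  let e : A ≃ B :=
    { toFun := fun x => ⟨c • (x : E), hmem x⟩
      invFun := fun y => ⟨c⁻¹ • (y : E), hmem' y⟩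
      left_inv := fun x => Subtype.ext (by simp [smul_smul, inv_mul_cancel₀ hc0])
      right_inv := fun y => Subtype.ext (by simp [smul_smul, mul_inv_cancel₀ hc0]) }
  unfold gaussianMass
  simp only [sub_zero]
  rw [← Equiv.tsum_eq e.symm]
  refine tsum_congr fun y => ?_
  change ENNReal.ofReal (gaussianFunction (1 / s) (c⁻¹ • (y : E))) = ENNReal.ofReal (gaussianFunction (1 / (s / c)) (y : E))
  rw [show (1 / s : ℝ) = c⁻¹ * (1 / (s / c)) by field_simp, gaussianFunction_smul _ (inv_ne_zero hc0)]

/-- **The smoothing parameter scales**: `η_ε(c · L) = c · η_ε(L)` for `c > 0`. [cite: MicciancioRegev2007, Def. 3.1 (with MicciancioGoldwasser2002 Ch. 1 §1)] -/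
theorem smoothingParameter_pointwise_smul (L : Submodule ℤ E) {c : ℝ} (hc : 0 < c) (ε : ℝ) :
    smoothingParameter (c • L) ε = c * smoothingParameter L ε := by
  have hc0 : c ≠ 0 := hc.ne'
  unfold smoothingParameter
  have hset : {s : ℝ | 0 < s ∧ gaussianMass (1 / s) 0 ((dualLattice (c • L) : Set E) \ {0}) ≤ ENNReal.ofReal ε} =
      c • {s : ℝ | 0 < s ∧ gaussianMass (1 / s) 0 ((dualLattice L : Set E) \ {0}) ≤ ENNReal.ofReal ε} := by
    ext s
    rw [Set.mem_smul_set]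
    simp only [Set.mem_setOf_eq, gaussianMass_inv_dual_smul L hc]
    constructor
    · rintro ⟨hs, hm⟩
      exact ⟨s / c, ⟨div_pos hs hc, hm⟩, by rw [smul_eq_mul, mul_div_cancel₀ _ hc0]⟩
    · rintro ⟨t, ⟨ht, hm⟩, rfl⟩
      refine ⟨by rw [smul_eq_mul]; exact mul_pos hc ht, ?_⟩
      rwa [smul_eq_mul, mul_div_cancel_left₀ _ hc0]
  rw [hset, Real.sInf_smul_of_nonneg hc.le, smul_eq_mul]

end MRThm59

end Literature.Algebra.EuclideanLattices

end
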